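import Literature.Combinatorics.Sahi2008.Indicators

/-!
# `NoHeavyLowerTail` (crux stmt-CriticalPhenomena-4575), Sahi programme (prim-master-conj gen 40): BRIDGE B, part 1 — the
# FULL-POLARISATION (orbit-averaging) identity for Sahi's `E₃` of three indicator functions under a product weight on `α × β × γ`

Support file (`--supports stmt-CriticalPhenomena-4575`).  Pure algebra over `Literature.Combinatorics.Sahi2008` (`ex`, `sahiE`, `setInd`).

For a weight `μ p = w₁ p.1 · w₂ p.2.1 · w₃ p.2.2` on `P = α × β × γ` with `Σ_p μ p = 1` and finsets `a, b, c ⊆ P`: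
* `sahiE_three_setInd_eq_sum_trip` — `E₃(1_a,1_b,1_c) = Σ_{t : Fin 3 → P} (Π_j μ (t j)) · G_{abc}(t)`,
  `G(t) = 2[t₀∈abc] − [t₀∈a][t₁∈bc] − [t₀∈b][t₁∈ac] − [t₀∈c][t₁∈ab] + [t₀∈a][t₁∈b][t₂∈c]` (three independent copies;
  `Fintype.prod_sum`);
* `actTrip π t` — the action of `π ∈ (Perm (Fin 3))³` on triples of points, permuting on each axis separately which point carries
  which coordinate; `W_actTrip` — the weight `Π_j μ (t j)` of a product weight is invariant; `actTripEquiv` — it is a bijection;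
* `sum_trip_eq_sum_orbitAvg` — hence `Σ_t W(t) G(t) = Σ_t W(t) · (Σ_π G(π·t)) / 216`;
* `sahiE_three_setInd_nonneg_of_orbitSum_nonneg` — **if `Σ_{π} G_{abc}(π·t) ≥ 0` for every `t`, then `E₃(1_a,1_b,1_c) ≥ 0`**
  (nonnegative weights).  Part 2 (`…BridgeKernel`) shows the orbit sums are the integers `κ₃` of the three-chains kernel when
  `α, β, γ` are chains and `a, b, c` are up-sets, and concludes.
-/

namespace Summit.CriticalPhenomena.PercolationContinuityZ3.Theorems.SahiThreeChains

open Finset Literature.Combinatorics.Sahi2008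

variable {α β γ : Type*} [Fintype α] [Fintype β] [Fintype γ] [DecidableEq α] [DecidableEq β] [DecidableEq γ]

/-- A triple of points of `P = α × β × γ` (three independent copies). [this work] -/
abbrev Trip (α β γ : Type*) := Fin 3 → α × β × γ

/-- The weight of a triple: `Π_j μ (t j)`. [this work] -/
def W (μ : α × β × γ → ℝ) (t : Trip α β γ) : ℝ := ∏ j, μ (t j)

/-- `0/1` indicator of a finset at a point (`= setInd`). [this work] -/
def chi (s : Finset (α × β × γ)) (p : α × β × γ) : ℝ := if p ∈ s then 1 else 0

omit [Fintype α] [Fintype β] [Fintype γ] in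
/-- `chi = setInd`. [this work] -/
theorem chi_eq_setInd (s : Finset (α × β × γ)) : chi s = setInd s := by
  funext p; rfl

/-- The integrand `G_{abc}(t) = 2[t₀∈abc] − [t₀∈a][t₁∈bc] − [t₀∈b][t₁∈ac] − [t₀∈c][t₁∈ab] + [t₀∈a][t₁∈b][t₂∈c]`. [this work] -/
def Gfun (a b c : Finset (α × β × γ)) (t : Trip α β γ) : ℝ :=
  2 * (chi a (t 0) * chi b (t 0) * chi c (t 0)) - chi a (t 0) * (chi b (t 1) * chi c (t 1))
    - chi b (t 0) * (chi a (t 1) * chi c (t 1)) - chi c (t 0) * (chi a (t 1) * chi b (t 1))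
    + chi a (t 0) * chi b (t 1) * chi c (t 2)

omit [DecidableEq α] [DecidableEq β] [DecidableEq γ] in
/-- Three independent copies: `Π_j E_μ(F_j) = Σ_t W(t) Π_j F_j(t_j)`. [this work] -/
theorem prod_ex_eq_sum_trip (μ : α × β × γ → ℝ) (F : Fin 3 → α × β × γ → ℝ) :
    ∏ j, ex μ (F j) = ∑ t : Trip α β γ, W μ t * ∏ j, F j (t j) := by
  simp only [ex]
  rw [Fintype.prod_sum (fun j p => μ p * F j p)]
  refine sum_congr rfl fun t _ => ?_
  rw [W, ← prod_mul_distrib]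

/-- **`E₃` of three indicators as a sum over triples of independent copies** (probability weight). [this work] -/
theorem sahiE_three_setInd_eq_sum_trip (μ : α × β × γ → ℝ) (hμ : ∑ p, μ p = 1) (a b c : Finset (α × β × γ)) :
    sahiE μ 3 ![setInd a, setInd b, setInd c] = ∑ t : Trip α β γ, W μ t * Gfun a b c t := by
  have h1 : ex μ 1 = 1 := ex_one hμ
  -- the five products of expectations as sums over triples
  have e1 : ex μ (chi a * chi b * chi c) * ex μ 1 * ex μ 1 =
      ∑ t : Trip α β γ, W μ t * (chi a (t 0) * chi b (t 0) * chi c (t 0)) := by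
    have := prod_ex_eq_sum_trip μ ![chi a * chi b * chi c, 1, 1]
    rw [Fin.prod_univ_three] at this
    simp only [Matrix.cons_val_zero, Matrix.cons_val_one, Matrix.cons_val] at this
    rw [this]
    refine sum_congr rfl fun t _ => ?_
    rw [Fin.prod_univ_three]
    simp
  have e2 : ∀ (u v w : Finset (α × β × γ)), ex μ (chi u) * ex μ (chi v * chi w) * ex μ 1 =
      ∑ t : Trip α β γ, W μ t * (chi u (t 0) * (chi v (t 1) * chi w (t 1))) := by
    intro u v w
    have := prod_ex_eq_sum_trip μ ![chi u, chi v * chi w, 1]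
    rw [Fin.prod_univ_three] at this
    simp only [Matrix.cons_val_zero, Matrix.cons_val_one, Matrix.cons_val] at this
    rw [this]
    refine sum_congr rfl fun t _ => ?_
    rw [Fin.prod_univ_three]
    simp
  have e3 : ex μ (chi a) * ex μ (chi b) * ex μ (chi c) =
      ∑ t : Trip α β γ, W μ t * (chi a (t 0) * chi b (t 1) * chi c (t 2)) := by
    have := prod_ex_eq_sum_trip μ ![chi a, chi b, chi c]
    rw [Fin.prod_univ_three] at this
    simp only [Matrix.cons_val_zero, Matrix.cons_val_one, Matrix.cons_val] at this
    rw [this]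
    refine sum_congr rfl fun t _ => ?_
    rw [Fin.prod_univ_three]
    simp [mul_assoc]
  rw [sahiE_three, ← chi_eq_setInd, ← chi_eq_setInd, ← chi_eq_setInd]
  have hG : ∑ t : Trip α β γ, W μ t * Gfun a b c t =
      2 * ∑ t : Trip α β γ, W μ t * (chi a (t 0) * chi b (t 0) * chi c (t 0))
      - ∑ t : Trip α β γ, W μ t * (chi a (t 0) * (chi b (t 1) * chi c (t 1)))
      - ∑ t : Trip α β γ, W μ t * (chi b (t 0) * (chi a (t 1) * chi c (t 1)))
      - ∑ t : Trip α β γ, W μ t * (chi c (t 0) * (chi a (t 1) * chi b (t 1)))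
      + ∑ t : Trip α β γ, W μ t * (chi a (t 0) * chi b (t 1) * chi c (t 2)) := by
    simp only [Gfun, mul_sum, ← sum_sub_distrib, ← sum_add_distrib]
    exact sum_congr rfl fun t _ => by ring
  rw [hG, ← e1, ← e2 a b c, ← e2 b a c, ← e2 c a b, ← e3, h1]
  ring

/-! ## The coordinate-permuting action of `(Perm (Fin 3))³` on triples of points -/

/-- The group acting: a permutation of the three copies for each of the three axes. [this work] -/
abbrev Perm3 := Equiv.Perm (Fin 3) × Equiv.Perm (Fin 3) × Equiv.Perm (Fin 3)

/-- `π · t`: on each axis separately, permute which copy carries which coordinate. [this work] -/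
def actTrip (π : Perm3) (t : Trip α β γ) : Trip α β γ :=
  fun j => ((t (π.1 j)).1, (t (π.2.1 j)).2.1, (t (π.2.2 j)).2.2)

omit [Fintype α] [Fintype β] [Fintype γ] [DecidableEq α] [DecidableEq β] [DecidableEq γ] in
/-- Acting by `π` and then by the componentwise inverses gives back `t`. [this work] -/
theorem actTrip_inv_act (π : Perm3) (t : Trip α β γ) : actTrip (π.1⁻¹, π.2.1⁻¹, π.2.2⁻¹) (actTrip π t) = t := by
  funext j
  simp [actTrip]

omit [Fintype α] [Fintype β] [Fintype γ] [DecidableEq α] [DecidableEq β] [DecidableEq γ] in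
/-- Acting by the componentwise inverses and then by `π` gives back `t`. [this work] -/
theorem actTrip_act_inv (π : Perm3) (t : Trip α β γ) : actTrip π (actTrip (π.1⁻¹, π.2.1⁻¹, π.2.2⁻¹) t) = t := by
  funext j
  simp [actTrip]

/-- The action of `π` as a bijection of the triples. [this work] -/
def actTripEquiv (π : Perm3) : Trip α β γ ≃ Trip α β γ where
  toFun := actTrip π
  invFun := actTrip (π.1⁻¹, π.2.1⁻¹, π.2.2⁻¹)
  left_inv := actTrip_inv_act π
  right_inv := actTrip_act_inv π

/-- The product weight `w₁ ⊗ w₂ ⊗ w₃` on `α × β × γ`. [this work] -/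
def prodW (w₁ : α → ℝ) (w₂ : β → ℝ) (w₃ : γ → ℝ) : α × β × γ → ℝ := fun p => w₁ p.1 * w₂ p.2.1 * w₃ p.2.2

omit [Fintype α] [Fintype β] [Fintype γ] [DecidableEq α] [DecidableEq β] [DecidableEq γ] in
/-- The weight of a triple is invariant under the action (the multiset of coordinates on each axis is preserved). [this work] -/
theorem W_actTrip (w₁ : α → ℝ) (w₂ : β → ℝ) (w₃ : γ → ℝ) (π : Perm3) (t : Trip α β γ) :
    W (prodW w₁ w₂ w₃) (actTrip π t) = W (prodW w₁ w₂ w₃) t := by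
  simp only [W, prodW, actTrip, prod_mul_distrib]
  rw [Equiv.prod_comp π.1 (fun j => w₁ (t j).1), Equiv.prod_comp π.2.1 (fun j => w₂ (t j).2.1),
    Equiv.prod_comp π.2.2 (fun j => w₃ (t j).2.2)]

omit [DecidableEq α] [DecidableEq β] [DecidableEq γ] in
/-- Re-indexing the triple sum by the action. [this work] -/
theorem sum_trip_act (w₁ : α → ℝ) (w₂ : β → ℝ) (w₃ : γ → ℝ) (G : Trip α β γ → ℝ) (π : Perm3) :
    ∑ t : Trip α β γ, W (prodW w₁ w₂ w₃) t * G (actTrip π t) = ∑ t : Trip α β γ, W (prodW w₁ w₂ w₃) t * G t := by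
  have := Equiv.sum_comp (actTripEquiv (α := α) (β := β) (γ := γ) π) (fun t => W (prodW w₁ w₂ w₃) t * G t)
  rw [← this]
  refine sum_congr rfl fun t _ => ?_
  show W (prodW w₁ w₂ w₃) t * G (actTrip π t) = W (prodW w₁ w₂ w₃) (actTrip π t) * G (actTrip π t)
  rw [W_actTrip]

omit [DecidableEq α] [DecidableEq β] [DecidableEq γ] in
/-- **Orbit averaging**: `Σ_t W(t) G(t) = Σ_t W(t) · (Σ_π G(π·t)) / |Perm3|`. [this work] -/
theorem sum_trip_eq_sum_orbitAvg (w₁ : α → ℝ) (w₂ : β → ℝ) (w₃ : γ → ℝ) (G : Trip α β γ → ℝ) :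
    ∑ t : Trip α β γ, W (prodW w₁ w₂ w₃) t * G t =
      ∑ t : Trip α β γ, W (prodW w₁ w₂ w₃) t * ((∑ π : Perm3, G (actTrip π t)) / Fintype.card Perm3) := by
  have hN : (Fintype.card Perm3 : ℝ) ≠ 0 := by exact_mod_cast Fintype.card_ne_zero
  have key : ∑ t : Trip α β γ, W (prodW w₁ w₂ w₃) t * (∑ π : Perm3, G (actTrip π t)) =
      (Fintype.card Perm3 : ℝ) * ∑ t : Trip α β γ, W (prodW w₁ w₂ w₃) t * G t := by
    calc ∑ t : Trip α β γ, W (prodW w₁ w₂ w₃) t * (∑ π : Perm3, G (actTrip π t))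
        = ∑ t : Trip α β γ, ∑ π : Perm3, W (prodW w₁ w₂ w₃) t * G (actTrip π t) := by simp_rw [mul_sum]
      _ = ∑ π : Perm3, ∑ t : Trip α β γ, W (prodW w₁ w₂ w₃) t * G (actTrip π t) := sum_comm
      _ = ∑ π : Perm3, ∑ t : Trip α β γ, W (prodW w₁ w₂ w₃) t * G t :=
          sum_congr rfl fun π _ => sum_trip_act w₁ w₂ w₃ G π
      _ = (Fintype.card Perm3 : ℝ) * ∑ t : Trip α β γ, W (prodW w₁ w₂ w₃) t * G t := by
          rw [sum_const, card_univ, nsmul_eq_mul]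
  symm
  calc ∑ t : Trip α β γ, W (prodW w₁ w₂ w₃) t * ((∑ π : Perm3, G (actTrip π t)) / Fintype.card Perm3)
      = (∑ t : Trip α β γ, W (prodW w₁ w₂ w₃) t * (∑ π : Perm3, G (actTrip π t))) / Fintype.card Perm3 := by
        rw [sum_div]
        exact sum_congr rfl fun t _ => by ring
    _ = ∑ t : Trip α β γ, W (prodW w₁ w₂ w₃) t * G t := by
        rw [key, mul_div_cancel_left₀ _ hN]

omit [Fintype α] [Fintype β] [Fintype γ] [DecidableEq α] [DecidableEq β] [DecidableEq γ] in
/-- The weight of a triple is nonnegative for nonnegative marginal weights. [this work] -/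
theorem W_nonneg {w₁ : α → ℝ} {w₂ : β → ℝ} {w₃ : γ → ℝ} (h₁ : ∀ x, 0 ≤ w₁ x) (h₂ : ∀ y, 0 ≤ w₂ y) (h₃ : ∀ z, 0 ≤ w₃ z)
    (t : Trip α β γ) : 0 ≤ W (prodW w₁ w₂ w₃) t :=
  prod_nonneg fun _ _ => mul_nonneg (mul_nonneg (h₁ _) (h₂ _)) (h₃ _)

/-- **Reduction to orbit sums**: if `Σ_π G_{abc}(π·t) ≥ 0` for every triple `t`, then `E₃(1_a,1_b,1_c) ≥ 0` under the product
weight `w₁ ⊗ w₂ ⊗ w₃` (nonnegative, total mass one). [this work] -/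
theorem sahiE_three_setInd_nonneg_of_orbitSum_nonneg {w₁ : α → ℝ} {w₂ : β → ℝ} {w₃ : γ → ℝ} (h₁ : ∀ x, 0 ≤ w₁ x)
    (h₂ : ∀ y, 0 ≤ w₂ y) (h₃ : ∀ z, 0 ≤ w₃ z) (hμ : ∑ p, prodW w₁ w₂ w₃ p = 1) (a b c : Finset (α × β × γ))
    (horb : ∀ t : Trip α β γ, 0 ≤ ∑ π : Perm3, Gfun a b c (actTrip π t)) :
    0 ≤ sahiE (prodW w₁ w₂ w₃) 3 ![setInd a, setInd b, setInd c] := by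
  rw [sahiE_three_setInd_eq_sum_trip _ hμ, sum_trip_eq_sum_orbitAvg]
  exact sum_nonneg fun t _ => mul_nonneg (W_nonneg h₁ h₂ h₃ t) (div_nonneg (horb t) (Nat.cast_nonneg _))

end Summit.CriticalPhenomena.PercolationContinuityZ3.Theorems.SahiThreeChains
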